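import Mathlib
import Summits.NavierStokesRegularity.NavierStokesRegularity.Theorems.FilamentSkeletonRssClause13RRateColumnFloor

/-!
# Clause 13-R on a NEAR-STRAIGHT filament: the rate column reaches `√Γ` INSIDE the tangency ball, and the `Y ≡ 0` instance of
# the rate row (line `rate_bordered_split` of crux `Clause13RNearStraightL`, stmt-NavierStokesRegularity-23612, STUB R `stub_rateRow13RFlat`)

Route `FilamentSkeletonRss`, Variant A1R.  STUB R of the registered line `Cruxes/Clause13RNearStraightL/Lines/rate_bordered_split.lean`
(`RateRow13RFlat`) says: a FLAT bordered linearised defect `‖DT·Y − dα·R_j‖ ≤ L` on the tangency ball `‖X_j τ‖ ≤ R_b√(Γ log Γ)` forces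
`|dα|√Γ ≤ cnd·L`, where `R_j(τ) = e₃ × X_j(τ) − ⟪e₃ × X_j(τ), X_j′(τ)⟫X_j′(τ)` is the RATE COLUMN.  The landed calibration
`…Clause13RRateColumnFloor.rateColumn_norm_ge` is for a STRAIGHT filament only.  This file carries it to the crux's actual
near-straight class and proves the `Y ≡ 0` instance of STUB R in clause currency:

* `norm_sub_chord_le` — near-straightness `‖X′τ − X′σ‖ ≤ R_b` (the crux's tolerance clause) gives the chord deviation
  `‖X τ − X c − (τ−c)•X′c‖ ≤ R_b|τ−c|` (mean value inequality);
* `norm_proj_sub_proj_le` — moving the normal projection from `X′τ` to `X′c` costs `2R_b‖v‖`;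
* `rateColumn_norm_ge_nearStraight` — **near-straight rate-column floor**
  `‖R(τ)‖ ≥ |τ−c|(√(θ₀(2−θ₀)) − 3R_b) − (1 + 2R_b)‖X c‖` (tilt clause 10 at the waist, unit speed);
* `exists_inBall_rateColumn_ge` — for `R_b ≤ min (s₀/6) (1/2)` (`s₀ = √(θ₀(2−θ₀))`), waist `‖X c‖ ≤ R_w√Γ` (clause 9) and
  `Γ ≥ Γ_R := max 1 (exp (((R_w + (4R_w+2)/s₀)/R_b)^2))` there is a parameter `τ` INSIDE the tangency ball with `‖R(τ)‖ ≥ √Γ`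
  (the threshold is written out inline everywhere: this helper file declares no definitions);
* `rateRow_zeroVariation` — hence the `Y ≡ 0` instance of the rate row with `cnd = 1`: if `‖0 − dα•R(τ)‖ ≤ L` on the ball then
  `|dα|√Γ ≤ L`;
* `rateRow13RFlat_zeroVariation` — the same in the LITERAL currency of `RateRow13RFlat` (its text with the extra hypothesis
  `∀ j τ, Y j τ = 0`; the `deriv` of the constant family `s ↦ T X j τ` is `0`), with `Rb₀ := min (s₀/6) (1/2)`, `cnd := 1`,
  `Γ₀ := Γ_R`: the consistency of the line's choice `a := 0` (critic PR-1) at CLAUSE level, uniformly in `b`.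

Only clauses 3 (unit speed, `C²`), 9 (waist), 10 (tilt) and the near-straight tolerance (i) are inspected.  Hand
`leafhand-ns-filamentskeletonrs-3-g0` (LAND-ONLY); `--supports stmt-NavierStokesRegularity-23612 --as helper`.
HONEST FRAMING: elementary geometry of a HYPOTHETICAL near-straight filament skeleton on the NEGATIVE side of a MODEL blow-up route;
nothing here bears on Navier–Stokes regularity or blow-up, and STUB R itself (all admissible `Y`) is NOT proved here.
-/

noncomputable section

open Real Filter MeasureTheory Literature.Analysis.FluidPDE
open scoped RealInnerProductSpace InnerProductSpace Topology BigOperators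
open Summit.NavierStokesRegularity.NavierStokesRegularity.Theorems.MatchedKernel
  (norm_sub_inner_smul_le norm_cross_single_two_le rateColumn_norm_ge)

namespace Summit.NavierStokesRegularity.NavierStokesRegularity.Theorems.Clause13RRateRow
set_option linter.dupNamespace false

/-! ## §1 Near-straight geometry -/

/-- Unit speed: `‖X τ − X c‖ ≤ |τ − c|`. [folklore] -/
theorem norm_sub_waist_le {X : ℝ → EuclideanSpace ℝ (Fin 3)} (hX : Differentiable ℝ X) (hunit : ∀ σ, ‖deriv X σ‖ = 1)
    (c τ : ℝ) : ‖X τ - X c‖ ≤ |τ - c| := by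
  have h := Convex.norm_image_sub_le_of_norm_deriv_le (f := X) (C := 1) (fun r _ => hX r)
    (fun r _ => (hunit r).le) convex_univ (Set.mem_univ c) (Set.mem_univ τ)
  simpa [Real.norm_eq_abs] using h

/-- Unit-speed envelope: `‖X τ‖ ≤ ‖X c‖ + |τ − c|`. [folklore] -/
theorem norm_le_waist_add {X : ℝ → EuclideanSpace ℝ (Fin 3)} (hX : Differentiable ℝ X) (hunit : ∀ σ, ‖deriv X σ‖ = 1)
    (c τ : ℝ) : ‖X τ‖ ≤ ‖X c‖ + |τ - c| := by
  have h := norm_sub_waist_le hX hunit c τ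
  calc ‖X τ‖ = ‖X c + (X τ - X c)‖ := by rw [add_sub_cancel]
    _ ≤ ‖X c‖ + ‖X τ - X c‖ := norm_add_le _ _
    _ ≤ ‖X c‖ + |τ - c| := by linarith

/-- **Chord deviation of a near-straight curve**: if the tangent oscillates by at most `R_b` (`‖X′τ − X′σ‖ ≤ R_b`, the crux's
near-straight tolerance), then `‖X τ − X c − (τ−c)•X′c‖ ≤ R_b·|τ − c|` (mean value inequality for `σ ↦ X σ − σ•X′c`). [folklore] -/
theorem norm_sub_chord_le {X : ℝ → EuclideanSpace ℝ (Fin 3)} {Rb : ℝ} (hX : Differentiable ℝ X)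
    (hns : ∀ τ σ, ‖deriv X τ - deriv X σ‖ ≤ Rb) (c τ : ℝ) :
    ‖X τ - X c - (τ - c) • deriv X c‖ ≤ Rb * |τ - c| := by
  have hF : ∀ σ ∈ (Set.univ : Set ℝ),
      HasDerivWithinAt (fun σ => X σ - σ • deriv X c) (deriv X σ - deriv X c) Set.univ σ := by
    intro σ _
    have h1 : HasDerivAt (fun σ : ℝ => σ • deriv X c) ((1:ℝ) • deriv X c) σ := (hasDerivAt_id σ).smul_const _
    rw [one_smul] at h1
    exact ((hX σ).hasDerivAt.sub h1).hasDerivWithinAt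
  have h := Convex.norm_image_sub_le_of_norm_hasDerivWithin_le hF (fun σ _ => hns σ c) convex_univ
    (Set.mem_univ c) (Set.mem_univ τ)
  have heq : (X τ - τ • deriv X c) - (X c - c • deriv X c) = X τ - X c - (τ - c) • deriv X c := by
    rw [sub_smul]; abel
  rw [heq, Real.norm_eq_abs] at h
  exact h

/-- Moving the normal projection between nearby unit vectors: `‖P_n v − P_t v‖ ≤ 2‖n − t‖·‖v‖` (`P_t v = v − ⟪v,t⟫t`). [folklore] -/
theorem norm_proj_sub_proj_le (v t n : EuclideanSpace ℝ (Fin 3)) (ht : ‖t‖ = 1) (hn : ‖n‖ = 1) :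
    ‖(v - ⟪v, n⟫ • n) - (v - ⟪v, t⟫ • t)‖ ≤ 2 * ‖n - t‖ * ‖v‖ := by
  have heq : (v - ⟪v, n⟫ • n) - (v - ⟪v, t⟫ • t) = ⟪v, t - n⟫ • t + ⟪v, n⟫ • (t - n) := by
    rw [inner_sub_right, sub_smul, smul_sub]; abel
  rw [heq]
  have h1 : ‖⟪v, t - n⟫ • t‖ ≤ ‖n - t‖ * ‖v‖ := by
    rw [norm_smul, Real.norm_eq_abs, ht, mul_one]
    calc |⟪v, t - n⟫| ≤ ‖v‖ * ‖t - n‖ := abs_real_inner_le_norm _ _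
      _ = ‖n - t‖ * ‖v‖ := by rw [norm_sub_rev, mul_comm]
  have h2 : ‖⟪v, n⟫ • (t - n)‖ ≤ ‖n - t‖ * ‖v‖ := by
    rw [norm_smul, Real.norm_eq_abs, norm_sub_rev]
    calc |⟪v, n⟫| * ‖n - t‖ ≤ (‖v‖ * ‖n‖) * ‖n - t‖ :=
          mul_le_mul_of_nonneg_right (abs_real_inner_le_norm _ _) (norm_nonneg _)
      _ = ‖n - t‖ * ‖v‖ := by rw [hn, mul_one, mul_comm]
  calc ‖⟪v, t - n⟫ • t + ⟪v, n⟫ • (t - n)‖ ≤ ‖⟪v, t - n⟫ • t‖ + ‖⟪v, n⟫ • (t - n)‖ := norm_add_le _ _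
    _ ≤ 2 * ‖n - t‖ * ‖v‖ := by linarith

/-- The normal projection is additive: `P_t(a + b) = P_t a + P_t b`. [folklore] -/
theorem proj_add (a b t : EuclideanSpace ℝ (Fin 3)) :
    (a + b) - ⟪a + b, t⟫ • t = (a - ⟪a, t⟫ • t) + (b - ⟪b, t⟫ • t) := by
  rw [inner_add_left, add_smul]; abel

/-- The cross product with `e₃` is additive in the second slot (via the bundled `crossCLM`). [folklore] -/
theorem cross_single_two_add (a b : EuclideanSpace ℝ (Fin 3)) :
    cross (EuclideanSpace.single 2 (1:ℝ)) (a + b) = cross (EuclideanSpace.single 2 (1:ℝ)) a + cross (EuclideanSpace.single 2 (1:ℝ)) b := by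
  rw [← crossCLM_apply, map_add, crossCLM_apply, crossCLM_apply]

/-- **NEAR-STRAIGHT RATE-COLUMN FLOOR.**  For a unit-speed differentiable curve with tangent oscillation `≤ R_b` and tilt
`|⟪X′c, e₃⟫| ≤ 1 − θ₀` at the waist parameter `c`:
`‖e₃ × X τ − ⟪e₃ × X τ, X′τ⟫X′τ‖ ≥ |τ−c|(√(θ₀(2−θ₀)) − 3R_b) − (1 + 2R_b)‖X c‖`. [folklore] -/
theorem rateColumn_norm_ge_nearStraight {X : ℝ → EuclideanSpace ℝ (Fin 3)} {Rb θ₀ : ℝ} (hX : Differentiable ℝ X)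
    (hunit : ∀ σ, ‖deriv X σ‖ = 1) (hns : ∀ τ σ, ‖deriv X τ - deriv X σ‖ ≤ Rb) (c : ℝ)
    (htilt : |⟪deriv X c, EuclideanSpace.single 2 (1:ℝ)⟫| ≤ 1 - θ₀) (τ : ℝ) :
    |τ - c| * (Real.sqrt (θ₀ * (2 - θ₀)) - 3 * Rb) - (1 + 2 * Rb) * ‖X c‖
      ≤ ‖cross (EuclideanSpace.single 2 (1:ℝ)) (X τ) - ⟪cross (EuclideanSpace.single 2 (1:ℝ)) (X τ), deriv X τ⟫ • deriv X τ‖ := by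
  set e₃ : EuclideanSpace ℝ (Fin 3) := EuclideanSpace.single 2 (1:ℝ) with he₃
  set t := deriv X c with ht_def
  set n := deriv X τ with hn_def
  set x₀ := X c with hx₀
  set E := X τ - X c - (τ - c) • t with hE_def
  have ht : ‖t‖ = 1 := hunit c
  have hn : ‖n‖ = 1 := hunit τ
  have hRb0 : 0 ≤ Rb := le_trans (norm_nonneg _) (hns c c)
  have hE : ‖E‖ ≤ Rb * |τ - c| := norm_sub_chord_le hX hns c τ
  have hXτ : X τ = (x₀ + (τ - c) • t) + E := by rw [hE_def]; abel
  set v := cross e₃ (X τ) with hv_def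
  -- `‖v‖ ≤ ‖X τ‖ ≤ ‖x₀‖ + |τ - c|`
  have hv : ‖v‖ ≤ ‖x₀‖ + |τ - c| := le_trans (norm_cross_single_two_le _) (norm_le_waist_add hX hunit c τ)
  -- move the projection from `n` to `t`
  have hmove : ‖(v - ⟪v, n⟫ • n) - (v - ⟪v, t⟫ • t)‖ ≤ 2 * Rb * (‖x₀‖ + |τ - c|) := by
    have h := norm_proj_sub_proj_le v t n ht hn
    have hnt : ‖n - t‖ ≤ Rb := hns τ c
    calc ‖(v - ⟪v, n⟫ • n) - (v - ⟪v, t⟫ • t)‖ ≤ 2 * ‖n - t‖ * ‖v‖ := h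
      _ ≤ 2 * Rb * (‖x₀‖ + |τ - c|) := by
          have := mul_le_mul hnt hv (norm_nonneg _) hRb0
          linarith
  -- split `P_t v` into the straight part and the chord error
  have hsplit : v - ⟪v, t⟫ • t
      = (cross e₃ (x₀ + (τ - c) • t) - ⟪cross e₃ (x₀ + (τ - c) • t), t⟫ • t) + (cross e₃ E - ⟪cross e₃ E, t⟫ • t) := by
    rw [hv_def, hXτ, cross_single_two_add, proj_add]
  have hstraight : |τ - c| * Real.sqrt (θ₀ * (2 - θ₀)) - ‖x₀‖
      ≤ ‖cross e₃ (x₀ + (τ - c) • t) - ⟪cross e₃ (x₀ + (τ - c) • t), t⟫ • t‖ :=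
    rateColumn_norm_ge x₀ t ht htilt (τ - c)
  have herr : ‖cross e₃ E - ⟪cross e₃ E, t⟫ • t‖ ≤ Rb * |τ - c| :=
    le_trans (norm_sub_inner_smul_le _ t ht) (le_trans (norm_cross_single_two_le E) hE)
  -- assemble: ‖P_n v‖ ≥ ‖P_t v‖ − ‖P_n v − P_t v‖ ≥ (straight − err) − move
  have hPt : |τ - c| * Real.sqrt (θ₀ * (2 - θ₀)) - ‖x₀‖ - Rb * |τ - c| ≤ ‖v - ⟪v, t⟫ • t‖ := by
    rw [hsplit]
    have h := norm_sub_le ((cross e₃ (x₀ + (τ - c) • t) - ⟪cross e₃ (x₀ + (τ - c) • t), t⟫ • t)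
      + (cross e₃ E - ⟪cross e₃ E, t⟫ • t)) (cross e₃ E - ⟪cross e₃ E, t⟫ • t)
    rw [add_sub_cancel_right] at h
    linarith
  have hPn : ‖v - ⟪v, t⟫ • t‖ - ‖(v - ⟪v, n⟫ • n) - (v - ⟪v, t⟫ • t)‖ ≤ ‖v - ⟪v, n⟫ • n‖ := by
    have h := norm_sub_le (v - ⟪v, n⟫ • n) ((v - ⟪v, n⟫ • n) - (v - ⟪v, t⟫ • t))
    rw [sub_sub_cancel] at h
    linarith
  have hx₀0 : 0 ≤ ‖x₀‖ := norm_nonneg _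
  nlinarith [hPt, hPn, hmove, abs_nonneg (τ - c)]

/-! ## §2 A witness inside the tangency ball and the `Y ≡ 0` rate row -/

/-- Beyond the threshold `Γ_R(R_w, R_b, θ₀) := max 1 (exp (((R_w + (4R_w + 2)/√(θ₀(2−θ₀)))/R_b)^2))`:
`(R_w + (4R_w+2)/s₀)·√Γ ≤ R_b·√(Γ log Γ)`, i.e. the point `τ = c + (4R_w + 2)√Γ/s₀` of a unit-speed curve with waist `‖X c‖ ≤ R_w√Γ` lies
inside the tangency ball `‖X τ‖ ≤ R_b√(Γ log Γ)`. [folklore] -/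
theorem reach_le_ball_of_threshold_le {Rw Rb θ₀ Γ : ℝ} (hRb : 0 < Rb) (hRw : 0 ≤ Rw) (hθ : 0 < Real.sqrt (θ₀ * (2 - θ₀)))
    (hΓ : max 1 (Real.exp (((Rw + (4 * Rw + 2) / Real.sqrt (θ₀ * (2 - θ₀))) / Rb) ^ 2)) ≤ Γ) :
    (Rw + (4 * Rw + 2) / Real.sqrt (θ₀ * (2 - θ₀))) * Real.sqrt Γ ≤ Rb * Real.sqrt (Γ * Real.log Γ) := by
  set s₀ := Real.sqrt (θ₀ * (2 - θ₀)) with hs₀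
  set M := Rw + (4 * Rw + 2) / s₀ with hM
  have hM0 : 0 ≤ M := add_nonneg hRw (div_nonneg (by linarith) hθ.le)
  have hΓ1 : 1 ≤ Γ := le_trans (le_max_left _ _) hΓ
  have hΓ0 : 0 ≤ Γ := by linarith
  have hexp : Real.exp ((M / Rb) ^ 2) ≤ Γ := le_trans (le_max_right _ _) hΓ
  have hlog : (M / Rb) ^ 2 ≤ Real.log Γ := by
    rw [← Real.log_exp ((M / Rb) ^ 2)]
    exact Real.log_le_log (Real.exp_pos _) hexp
  have hMRb : M / Rb ≤ Real.sqrt (Real.log Γ) := by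
    rw [← Real.sqrt_sq (div_nonneg hM0 hRb.le)]
    exact Real.sqrt_le_sqrt hlog
  have hM' : M ≤ Rb * Real.sqrt (Real.log Γ) := by
    rw [div_le_iff₀ hRb] at hMRb; linarith
  rw [Real.sqrt_mul hΓ0, ← mul_assoc, mul_comm Rb, mul_assoc]
  rw [mul_comm M]
  exact mul_le_mul_of_nonneg_left hM' (Real.sqrt_nonneg _)

/-- **A WITNESS IN THE BALL.**  For a unit-speed differentiable curve with tangent oscillation `≤ R_b ≤ min (s₀/6) (1/2)`
(`s₀ = √(θ₀(2−θ₀))`), tilt `≤ 1 − θ₀` at `c`, waist `‖X c‖ ≤ R_w√Γ`, and `Γ ≥ Γ_R`, the parameter `τ = c + (4R_w+2)√Γ/s₀` lies in the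
tangency ball and carries a rate column of norm `≥ √Γ`. [folklore] -/
theorem exists_inBall_rateColumn_ge {X : ℝ → EuclideanSpace ℝ (Fin 3)} {Rb Rw θ₀ Γ : ℝ} (hX : Differentiable ℝ X)
    (hunit : ∀ σ, ‖deriv X σ‖ = 1) (hns : ∀ τ σ, ‖deriv X τ - deriv X σ‖ ≤ Rb) (c : ℝ)
    (htilt : |⟪deriv X c, EuclideanSpace.single 2 (1:ℝ)⟫| ≤ 1 - θ₀) (hθ₀ : 0 < θ₀) (hθ₁ : θ₀ ≤ 1)
    (hRb : 0 < Rb) (hRb₁ : Rb ≤ Real.sqrt (θ₀ * (2 - θ₀)) / 6) (hRb₂ : Rb ≤ 1 / 2) (hRw : 0 ≤ Rw)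
    (hwaist : ‖X c‖ ≤ Rw * Real.sqrt Γ)
    (hΓ : max 1 (Real.exp (((Rw + (4 * Rw + 2) / Real.sqrt (θ₀ * (2 - θ₀))) / Rb) ^ 2)) ≤ Γ) :
    ∃ τ : ℝ, ‖X τ‖ ≤ Rb * Real.sqrt (Γ * Real.log Γ) ∧
      Real.sqrt Γ ≤ ‖cross (EuclideanSpace.single 2 (1:ℝ)) (X τ) - ⟪cross (EuclideanSpace.single 2 (1:ℝ)) (X τ), deriv X τ⟫ • deriv X τ‖ := by
  set s₀ := Real.sqrt (θ₀ * (2 - θ₀)) with hs₀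
  have hs₀pos : 0 < s₀ := Real.sqrt_pos.2 (mul_pos hθ₀ (by linarith))
  set D := (4 * Rw + 2) * Real.sqrt Γ / s₀ with hD
  have hΓ1 : 1 ≤ Γ := le_trans (le_max_left _ _) hΓ
  have hsqΓ : 0 ≤ Real.sqrt Γ := Real.sqrt_nonneg _
  have hD0 : 0 ≤ D := div_nonneg (mul_nonneg (by linarith) hsqΓ) hs₀pos.le
  refine ⟨c + D, ?_, ?_⟩
  · -- in the ball: ‖X (c+D)‖ ≤ ‖X c‖ + D ≤ (R_w + (4R_w+2)/s₀)√Γ ≤ R_b√(Γ log Γ)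
    have h1 : ‖X (c + D)‖ ≤ Rw * Real.sqrt Γ + D := by
      have h := norm_le_waist_add hX hunit c (c + D)
      rw [show c + D - c = D by ring, abs_of_nonneg hD0] at h
      linarith
    have h2 : Rw * Real.sqrt Γ + D = (Rw + (4 * Rw + 2) / s₀) * Real.sqrt Γ := by
      rw [hD]; field_simp
    rw [h2] at h1
    exact le_trans h1 (reach_le_ball_of_threshold_le hRb hRw hs₀pos hΓ)
  · have hfloor := rateColumn_norm_ge_nearStraight hX hunit hns c htilt (c + D)
    rw [show c + D - c = D by ring, abs_of_nonneg hD0] at hfloor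
    -- `D(s₀ − 3R_b) − (1+2R_b)‖X c‖ ≥ D s₀/2 − 2R_w√Γ = √Γ`
    have h3 : s₀ / 2 ≤ s₀ - 3 * Rb := by linarith
    have h4 : (1 + 2 * Rb) * ‖X c‖ ≤ 2 * (Rw * Real.sqrt Γ) := by
      have := norm_nonneg (X c)
      nlinarith
    have h5 : D * (s₀ / 2) = (2 * Rw + 1) * Real.sqrt Γ := by
      rw [hD]; field_simp; ring
    have h6 : D * (s₀ / 2) ≤ D * (s₀ - 3 * Rb) := mul_le_mul_of_nonneg_left h3 hD0
    linarith

/-- **THE `Y ≡ 0` RATE ROW** (`cnd = 1`): under the hypotheses of `exists_inBall_rateColumn_ge`, if the column alone is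
bounded by `L` on the tangency ball — `‖0 − dα•R(τ)‖ ≤ L` whenever `‖X τ‖ ≤ R_b√(Γ log Γ)` — then `|dα|·√Γ ≤ L`. [folklore] -/
theorem rateRow_zeroVariation {X : ℝ → EuclideanSpace ℝ (Fin 3)} {Rb Rw θ₀ Γ : ℝ} (hX : Differentiable ℝ X)
    (hunit : ∀ σ, ‖deriv X σ‖ = 1) (hns : ∀ τ σ, ‖deriv X τ - deriv X σ‖ ≤ Rb) (c : ℝ)
    (htilt : |⟪deriv X c, EuclideanSpace.single 2 (1:ℝ)⟫| ≤ 1 - θ₀) (hθ₀ : 0 < θ₀) (hθ₁ : θ₀ ≤ 1)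
    (hRb : 0 < Rb) (hRb₁ : Rb ≤ Real.sqrt (θ₀ * (2 - θ₀)) / 6) (hRb₂ : Rb ≤ 1 / 2) (hRw : 0 ≤ Rw)
    (hwaist : ‖X c‖ ≤ Rw * Real.sqrt Γ)
    (hΓ : max 1 (Real.exp (((Rw + (4 * Rw + 2) / Real.sqrt (θ₀ * (2 - θ₀))) / Rb) ^ 2)) ≤ Γ) {dα L : ℝ}
    (hdef : ∀ τ, ‖X τ‖ ≤ Rb * Real.sqrt (Γ * Real.log Γ) →
      ‖(0 : EuclideanSpace ℝ (Fin 3)) - dα • (cross (EuclideanSpace.single 2 (1:ℝ)) (X τ)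
        - ⟪cross (EuclideanSpace.single 2 (1:ℝ)) (X τ), deriv X τ⟫ • deriv X τ)‖ ≤ L) :
    |dα| * Real.sqrt Γ ≤ L := by
  obtain ⟨τ, hin, hcol⟩ := exists_inBall_rateColumn_ge hX hunit hns c htilt hθ₀ hθ₁ hRb hRb₁ hRb₂ hRw hwaist hΓ
  have h := hdef τ hin
  rw [zero_sub, norm_neg, norm_smul, Real.norm_eq_abs] at h
  exact le_trans (mul_le_mul_of_nonneg_left hcol (abs_nonneg _)) h

/-! ## §3 The `Y ≡ 0` instance of STUB R in the LITERAL clause currency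

The statement below is the text of `RateRow13RFlat` (line `rate_bordered_split`, byte-identical up to the ONE inserted hypothesis
`(∀ j τ, Y j τ = 0) →` after `(∀ j, ContDiff ℝ 2 (Y j))→`).  Constants: `Rb₀ := min (√(θ₀(2−θ₀))/6) (1/2)`, `cnd := 1`,
`Γ₀ := max 1 (exp (((R_w + (4R_w+2)/√(θ₀(2−θ₀)))/R_b)^2))` — uniform in the envelope exponent `b`, as STUB R demands (`∀ b ∃ cnd Γ₀`).
For `θ₀ > 1` the tilt clause 10 is contradictory and the class is empty. -/

/-- **THE `Y ≡ 0` INSTANCE OF STUB R (`RateRow13RFlat`) AT CLAUSE LEVEL, `cnd = 1`.**  For the zero variation the family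
`s ↦ T (X + s•0) j τ` is constant, its `deriv` at `0` vanishes, and the flat bordered defect hypothesis reads `‖dα•R_j(τ)‖ ≤ L` on the
tangency ball; the near-straight rate-column floor puts a point with `‖R_j‖ ≥ √Γ` inside the ball of filament `j = 0`, whence
`|dα|√Γ ≤ L`.  Inspected clauses: 3 (unit speed, `C²`), 9 (waist), 10 (tilt), near-straight (i).  This is the consistency of the
line's `a := 0` (critic PR-1) in the crux's own currency; it is NOT stub R (which quantifies over all admissible `Y`). [folklore] -/
theorem rateRow13RFlat_zeroVariation :
    (open Literature.Analysis.FluidPDE in ∀ (N : ℕ) (δ ρ K Λ Rw cg θ₀ KA : ℝ), 0 < N → 0 < δ → 0 < ρ → 0 < Rw → 0 < cg → 0 < θ₀ → ∃ Rb₀ : ℝ, 0 < Rb₀ ∧ ∀ Rb : ℝ, 0 < Rb → Rb ≤ Rb₀ → ∀ b : ℝ, ∃ (cnd Γ₀ : ℝ), 0 < cnd ∧ ∀ Γ : ℝ, Γ₀ ≤ Γ → ∀ (γ : Fin N → ℝ) (α : ℝ) (X : Fin N → ℝ → EuclideanSpace ℝ (Fin 3)) (w : Fin N → ℝ → ℝ)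 (c : Fin N → ℝ) (Aa : Fin N → ℝ → ℝ), (∀ (u:(Fin N → ℝ → EuclideanSpace ℝ (Fin 3)) → EuclideanSpace ℝ (Fin 3) → EuclideanSpace ℝ (Fin 3)) (v:EuclideanSpace ℝ (Fin 3) → EuclideanSpace ℝ (Fin 3)) (A:Fin N → (EuclideanSpace ℝ (Fin 3) →L[ℝ] EuclideanSpace ℝ (Fin 3))) (T:(Fin N → ℝ → EuclideanSpace ℝ (Fin 3)) → Fin N → ℝ → EuclideanSpace ℝ (Fin 3)), (∀ Z y, u Z y = ∑ k, (Γ*γ k/(4*Real.pi))•∫ σ:ℝ, ((‖y-Z k σ‖^2+Real.exp (-(1+Real.eulerMascheroniConstant-Real.log 2))*Aa k σ)^(3/2:ℝ))⁻¹•cross (deriv (Z k) σ) (y-Z k σ))→(∀ y, v y = u X y+(1/2:ℝ)•y-α•cross (EuclideanSpace.single 2 1) y)→(∀ j, A j = fderiv ℝ v (X j (c j)))→(∀ Z j τ, T Z j τ = (u Z (Z j τ)+(1/2:ℝ)•Z j τ-α•cross (EuclideanSpace.single 2 1) (Z j τ))-(⟪u Z (Z j τ)+(1/2:ℝ)•Z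 j τ-α•cross (EuclideanSpace.single 2 1) (Z j τ), deriv (Z j) τ⟫_ℝ/‖deriv (Z j) τ‖^2)•deriv (Z j) τ)→(α ≠ 0 ∧ (∀ j, γ j ≠ 0) ∧ (∀ j, ContDiff ℝ 2 (X j) ∧ Differentiable ℝ (w j)∧(∀ τ, ‖deriv (X j) τ‖ = 1)∧(∀ τ, ‖iteratedDeriv 2 (X j) τ‖*√Γ≤K) ∧ Tendsto (fun τ => ‖X j τ‖) (cocompact ℝ) atTop) ∧ (∀ j k, j ≠ k → ∀ τ σ, ρ*√Γ≤‖X j τ-X k σ‖) ∧ (∀ j τ σ, ρ*√Γ≤|τ-σ| → cg*ρ*√Γ≤‖X j τ-X j σ‖) ∧ (∀ j τ, cg*|τ-c j|≤Rw*√Γ+‖X j τ‖) ∧ (∀ j τ, w j τ = ⟪v (X j τ), deriv (X j) τ⟫_ℝ) ∧ (∀ j τ, ‖X j τ‖≤Rb*√(Γ*Real.log Γ) → v (X j τ) = w j τ•deriv (X j) τ) ∧ (∀ j, ‖X j (c j)‖≤Rw*√Γ) ∧ (∀ j, |⟪deriv (X j) (c j), EuclideanSpace.single 2 1⟫_ℝ|≤1-θ₀)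 ∧ (θ₀≤|α| ∧ |α|≤θ₀⁻¹ ∧ ∀ j, θ₀≤|γ j| ∧ |γ j|≤θ₀⁻¹) ∧ (∀ j, w j (c j) = 0 ∧ (∀ τ, w j τ = 0 → τ = c j) ∧ 3/2+δ≤deriv (w j) (c j) ∧ deriv (w j) (c j)≤Λ) ∧ (∀ j, Differentiable ℝ (Aa j) ∧ (∀ τ, 0 < Aa j τ) ∧ 1≤KA*Aa j (c j) ∧ ∀ τ, ‖X j τ‖≤2*Rb*√(Γ*Real.log Γ) → Aa j τ = Aa j (c j)) ∧ (∀ j τ, Rw^2*Γ*Aa j τ≤KA*(Rw^2*Γ+‖X j τ‖^2)))) → ((∀ j τ σ, ‖deriv (X j) τ - deriv (X j) σ‖ ≤ Rb) ∧ (∀ j τ, |deriv (w j) τ| ≤ Λ) ∧ (∀ j τ, Λ⁻¹ ≤ Aa j τ)) → (∀ (u:(Fin N → ℝ → EuclideanSpace ℝ (Fin 3)) → EuclideanSpace ℝ (Fin 3) → EuclideanSpace ℝ (Fin 3)) (v:EuclideanSpace ℝ (Fin 3) → EuclideanSpace ℝ (Fin 3)) (A:Fin N → (EuclideanSpace ℝ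 (Fin 3) →L[ℝ] EuclideanSpace ℝ (Fin 3))) (T:(Fin N → ℝ → EuclideanSpace ℝ (Fin 3)) → Fin N → ℝ → EuclideanSpace ℝ (Fin 3)), (∀ Z y, u Z y = ∑ k, (Γ*γ k/(4*Real.pi))•∫ σ:ℝ, ((‖y-Z k σ‖^2+Real.exp (-(1+Real.eulerMascheroniConstant-Real.log 2))*Aa k σ)^(3/2:ℝ))⁻¹•cross (deriv (Z k) σ) (y-Z k σ))→(∀ y, v y = u X y+(1/2:ℝ)•y-α•cross (EuclideanSpace.single 2 1) y)→(∀ j, A j = fderiv ℝ v (X j (c j)))→(∀ Z j τ, T Z j τ = (u Z (Z j τ)+(1/2:ℝ)•Z j τ-α•cross (EuclideanSpace.single 2 1) (Z j τ))-(⟪u Z (Z j τ)+(1/2:ℝ)•Z j τ-α•cross (EuclideanSpace.single 2 1) (Z j τ), deriv (Z j) τ⟫_ℝ/‖deriv (Z j) τ‖^2)•deriv (Z j) τ)→(∀ Y:Fin N → ℝ → EuclideanSpace ℝ (Fin 3), (∀ j, ContDiff ℝ 2 (Y j))→(∀ j τ, Y j τ = 0) → (∀ j τ, ⟪Y j τ,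 deriv (X j) τ⟫_ℝ = 0) → (∀ j τ, Rb*√(Γ*Real.log Γ) < ‖X j τ‖ → Y j τ = 0) → ∑ j, ⟪Y j (c j), cross (EuclideanSpace.single 2 1) (X j (c j))⟫_ℝ = 0 → (∀ j τ, ‖Y j τ‖+‖deriv (Y j) τ‖+‖iteratedDeriv 2 (Y j) τ‖≤(1+|τ-c j|)^b) → ∀ dα L:ℝ, (∀ j τ, ‖X j τ‖≤Rb*√(Γ*Real.log Γ) → ‖deriv (fun s:ℝ => T (fun k σ => X k σ+s•Y k σ) j τ) 0-dα•(cross (EuclideanSpace.single 2 1) (X j τ)-⟪cross (EuclideanSpace.single 2 1) (X j τ), deriv (X j) τ⟫_ℝ•deriv (X j) τ)‖≤L) → |dα| * √Γ≤cnd*L))) := by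
  intro N δ ρ K Λ Rw cg θ₀ KA hN hδ hρ hRw hcg hθ₀
  by_cases hθ₁ : θ₀ ≤ 1
  · -- the honest case
    set s₀ := Real.sqrt (θ₀ * (2 - θ₀)) with hs₀
    have hs₀pos : 0 < s₀ := Real.sqrt_pos.2 (mul_pos hθ₀ (by linarith))
    refine ⟨min (s₀ / 6) (1 / 2), lt_min (by linarith) (by norm_num), fun Rb hRb hRb₀ b => ?_⟩
    refine ⟨1, max 1 (Real.exp (((Rw + (4 * Rw + 2) / Real.sqrt (θ₀ * (2 - θ₀))) / Rb) ^ 2)), one_pos, fun Γ hΓ => ?_⟩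
    intro γ α X w c Aa hH hNS u v A T hu hv hA hT Y hY2 hY0 hYn hYoff hYph hYenv dα L hdef
    obtain ⟨-, -, h3, -, -, -, -, -, h9, h10, -⟩ := hH u v A T hu hv hA hT
    set j : Fin N := ⟨0, hN⟩ with hj
    have hXd : Differentiable ℝ (X j) := (h3 j).1.differentiable (by norm_num)
    have hunit : ∀ σ, ‖deriv (X j) σ‖ = 1 := (h3 j).2.2.1
    have hns : ∀ τ σ, ‖deriv (X j) τ - deriv (X j) σ‖ ≤ Rb := hNS.1 j
    -- the displaced family is constant in `s`
    have hfam : ∀ s : ℝ, (fun k σ => X k σ + s • Y k σ) = X := fun s => by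
      funext k σ; rw [hY0 k σ, smul_zero, add_zero]
    have hderiv : ∀ τ, deriv (fun s : ℝ => T (fun k σ => X k σ + s • Y k σ) j τ) 0 = 0 := fun τ => by
      have : (fun s : ℝ => T (fun k σ => X k σ + s • Y k σ) j τ) = fun _ => T X j τ := by
        funext s; rw [hfam s]
      rw [this, deriv_const]
    rw [one_mul]
    refine rateRow_zeroVariation hXd hunit hns (c j) (h10 j) hθ₀ hθ₁ hRb (le_trans hRb₀ (min_le_left _ _))
      (le_trans hRb₀ (min_le_right _ _)) hRw.le (h9 j) hΓ (dα := dα) (L := L) fun τ hin => ?_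
    have h := hdef j τ hin
    rw [hderiv τ] at h
    exact h
  · -- `θ₀ > 1`: the tilt clause is contradictory, the class is empty
    refine ⟨1, one_pos, fun Rb hRb hRb₀ b => ⟨1, 0, one_pos, fun Γ hΓ => ?_⟩⟩
    intro γ α X w c Aa hH hNS u v A T hu hv hA hT Y hY2 hY0 hYn hYoff hYph hYenv dα L hdef
    obtain ⟨-, -, -, -, -, -, -, -, -, h10, -⟩ := hH u v A T hu hv hA hT
    have h := h10 ⟨0, hN⟩
    have habs := abs_nonneg ⟪deriv (X ⟨0, hN⟩) (c ⟨0, hN⟩), EuclideanSpace.single 2 (1:ℝ)⟫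
    exfalso
    linarith

end Summit.NavierStokesRegularity.NavierStokesRegularity.Theorems.Clause13RRateRow

end
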